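import Mathlib
import HarnessLib
import Summits.Langlands.Langlands.Theses.ParityBlindBianchi
import Summits.Langlands.Langlands.Theses.RuelleTorsionArtinWeight
import Summits.Langlands.Langlands.Theorems.ParityBlindBianchiArtinWeightRealisationLevelSharedOfLevel
import Summits.Langlands.Langlands.Theorems.ParityBlindBianchiArtinWeightRealisationLevelSolvableSector

/-!
# The icosahedral sector of R′ = `ParityBlindBianchi.ArtinWeightRealisationLevel` (stmt-Langlands-15111)
implies the icosahedral sector of the shared crux R = `RuelleTorsionArtinWeight.ArtinWeightRealisation`
(stmt-Langlands-11057) — companion to `…InsolubleCore`, continuation lead c2, line `Sketch` (`--supports`)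

`…SharedOfLevel` proves `R′ → R` unconditionally; its proof is pointwise in `(K, p, ι, σ)`, so the
same bookkeeping (`S₀ := insert p (S.image absNorm)`, restriction of the Hecke point along the
inclusion of index types `isHeckePoint_comp`, finiteness of the `S₀`-bad places
`finite_setOf_not_good`) gives the restricted arrow:

* `artinWeightRealisation_insoluble_of_artinWeightRealisationLevel_insoluble` :
  `(R′ restricted to ¬ IsSolvable (projectiveImage σ)) → (R restricted likewise)`, unconditionally;
* `artinWeightRealisation_of_artinWeightRealisationLevel_insoluble` :
  `strongArtin_of_isSolvable → (R′ restricted) → R` (solvable sector = Langlands–Tunnell verbatim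
  via the dual-transport API of `…SolvableSector`; in this direction neither the rigidity fact nor
  the cusp-form existence fact is needed).

With `…InsolubleCore` this completes the square: modulo {Langlands–Tunnell, Gelbart 1997 Prop. 4.1
σ-shadow, cusp forms on `GL₂/F` exist} the four statements R, R′, R|icosahedral, R′|icosahedral are
pairwise equivalent (kernel-checked).  The restrictions are hypotheses written out verbatim; nothing
is claimed about them.  No definitions.
-/

noncomputable section

open scoped BigOperators Topology Classical Matrix NumberField MatrixGroups
open Literature.NumberTheory.Automorphic Literature.NumberTheory.GaloisRepresentations
  IsDedekindDomain NumberField Filter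

-- `Summit.Langlands.Langlands.…`: summit = sub-problem name (D-0017 nested layout), not a typo.
set_option linter.dupNamespace false

namespace Summit.Langlands.Langlands.Theorems.ArtinWeightRealisationLevel

/-- **The icosahedral sector of R′ implies the icosahedral sector of R, unconditionally** (the
proof of `artinWeightRealisation_of_artinWeightRealisationLevel` is pointwise in `σ`: given R's
package `(S, U, ϖ, a)` take `S₀ := insert p (S.image absNorm)`; an `S₀`-good place is outside `S`,
the Hecke point restricts along the inclusion of index types (`isHeckePoint_comp`), R′ gives `π`
compatible at every `S₀`-good place, and the `S₀`-bad places are finitely many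
(`finite_setOf_not_good`)). [folklore] -/
theorem artinWeightRealisation_insoluble_of_artinWeightRealisationLevel_insoluble : (∀ (K : Type) [Field K] [NumberField K], NumberField.IsTotallyComplex K → Module.finrank ℚ K = 2 → ∀ (p : ℕ) [Fact p.Prime] (ι : PadicAlgCl p ≃+* ℂ) (σ : Literature.NumberTheory.GaloisRepresentations.FramedGaloisRep K (PadicAlgCl p) 2), Finite σ.toMonoidHom.range → σ.toGaloisRep.IsIrreducible → ¬ IsSolvable (Literature.NumberTheory.GaloisRepresentations.projectiveImage σ.toMonoidHom) → ∀ S₀ : Finset ℕ, p ∈ S₀ → (∃ (U : Subgroup (GL (Fin 2) (IsDedekindDomain.FiniteAdeleRing (NumberField.RingOfIntegers K) K))) (ϖ : ∀ v : IsDedekindDomain.HeightOneSpectrum (NumberField.RingOfIntegers K), (v.adicCompletion K)ˣ) (a : {v : IsDedekindDomain.HeightOneSpectrum (NumberField.RingOfIntegers K) // ∀ ℓ ∈ S₀, ((ℓ : ℕ) : NumberField.RingOfIntegers K) ∉ v.asIdeal} → ℕ → (Valued.v (R := PadicAlgCl p)).valuationSubring), IsOpen (U : Set (GL (Fin 2)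 (IsDedekindDomain.FiniteAdeleRing (NumberField.RingOfIntegers K) K))) ∧ U ≤ Literature.NumberTheory.Automorphic.glFiniteIntegralLevel 2 K ∧ (∀ g ∈ Literature.NumberTheory.Automorphic.glFiniteIntegralLevel 2 K, (∀ v : IsDedekindDomain.HeightOneSpectrum (NumberField.RingOfIntegers K), ¬ (∀ ℓ ∈ S₀, ((ℓ : ℕ) : NumberField.RingOfIntegers K) ∉ v.asIdeal) → ∀ i j : Fin 2, ((g : Matrix (Fin 2) (Fin 2) (IsDedekindDomain.FiniteAdeleRing (NumberField.RingOfIntegers K) K)) i j) v = (1 : Matrix (Fin 2) (Fin 2) (v.adicCompletion K)) i j) → g ∈ U) ∧ (∀ v : IsDedekindDomain.HeightOneSpectrum (NumberField.RingOfIntegers K), Valued.v ((ϖ v : (v.adicCompletion K)ˣ) : v.adicCompletion K) = WithZero.exp (-1 : ℤ)) ∧ Literature.NumberTheory.Automorphic.IsHeckePoint (Matrix.GeneralLinearGroup.map (n := Fin 2) (algebraMap K (IsDedekindDomain.FiniteAdeleRing (NumberField.RingOfIntegers K) K))) (Literature.NumberTheory.Automorphic.LevelTower.ofSeq U (fun r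 : ℕ => (Literature.NumberTheory.Automorphic.principalCongruenceLevel 2 K (Ideal.span {((p : ℕ) : NumberField.RingOfIntegers K)} ^ r)).map (Literature.NumberTheory.Automorphic.GLn.sndHom 2 K))) ((p : ℕ) : (Valued.v (R := PadicAlgCl p)).valuationSubring) (fun j : {v : IsDedekindDomain.HeightOneSpectrum (NumberField.RingOfIntegers K) // ∀ ℓ ∈ S₀, ((ℓ : ℕ) : NumberField.RingOfIntegers K) ∉ v.asIdeal} × Fin 2 => Literature.NumberTheory.Automorphic.GLn.sndHom 2 K (Literature.NumberTheory.Automorphic.heckeDiagAt 2 K j.1.1 (ϖ j.1.1) (j.2.val + 1))) (fun j => a j.1 (j.2.val + 1)) ∧ ∀ (v : IsDedekindDomain.HeightOneSpectrum (NumberField.RingOfIntegers K)) (hv : ∀ ℓ ∈ S₀, ((ℓ : ℕ) : NumberField.RingOfIntegers K) ∉ v.asIdeal), σ.IsHeckeAssociatedAt v (fun i : ℕ => if i = 0 then (1 : PadicAlgCl p) else ((a ⟨v, hv⟩ i : (Valued.v (R := PadicAlgCl p)).valuationSubring) : PadicAlgCl p))) → ∃ (hcpt : Literature.NumberTheory.Automorphic.isCompact_glFiniteIntegralLevel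 2 K) (π : Literature.NumberTheory.Automorphic.CuspidalAutomorphicRepData 2 K hcpt), ∀ w : IsDedekindDomain.HeightOneSpectrum (NumberField.RingOfIntegers K), (∀ ℓ ∈ S₀, ((ℓ : ℕ) : NumberField.RingOfIntegers K) ∉ w.asIdeal) → Summit.Langlands.SatakeFrobCompatibleAt ι π.1 σ w) → (∀ (K : Type) [Field K] [NumberField K], NumberField.IsTotallyComplex K → Module.finrank ℚ K = 2 → ∀ (p : ℕ) [Fact p.Prime] (ι : PadicAlgCl p ≃+* ℂ) (σ : Literature.NumberTheory.GaloisRepresentations.FramedGaloisRep K (PadicAlgCl p) 2), Finite σ.toMonoidHom.range → σ.toGaloisRep.IsIrreducible → ¬ IsSolvable (Literature.NumberTheory.GaloisRepresentations.projectiveImage σ.toMonoidHom) → (∃ (S : Finset (IsDedekindDomain.HeightOneSpectrum (NumberField.RingOfIntegers K))) (U : Subgroup (GL (Fin 2) (IsDedekindDomain.FiniteAdeleRing (NumberField.RingOfIntegers K) K))) (ϖ : ∀ v : IsDedekindDomain.HeightOneSpectrum (NumberField.RingOfIntegers K), (v.adicCompletion K)ˣ) (a : {v : IsDedekindDomain.HeightOneSpectrum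 (NumberField.RingOfIntegers K) // v ∉ S} → ℕ → (Valued.v (R := PadicAlgCl p)).valuationSubring), (∀ v : IsDedekindDomain.HeightOneSpectrum (NumberField.RingOfIntegers K), ((p : ℕ) : NumberField.RingOfIntegers K) ∈ v.asIdeal → v ∈ S) ∧ IsOpen (U : Set (GL (Fin 2) (IsDedekindDomain.FiniteAdeleRing (NumberField.RingOfIntegers K) K))) ∧ U ≤ Literature.NumberTheory.Automorphic.glFiniteIntegralLevel 2 K ∧ (∀ g ∈ Literature.NumberTheory.Automorphic.glFiniteIntegralLevel 2 K, (∀ v ∈ S, ∀ i j : Fin 2, ((g : Matrix (Fin 2) (Fin 2) (IsDedekindDomain.FiniteAdeleRing (NumberField.RingOfIntegers K) K)) i j) v = (1 : Matrix (Fin 2) (Fin 2) (v.adicCompletion K)) i j) → g ∈ U) ∧ (∀ v : IsDedekindDomain.HeightOneSpectrum (NumberField.RingOfIntegers K), Valued.v ((ϖ v : (v.adicCompletion K)ˣ) : v.adicCompletion K) = WithZero.exp (-1 : ℤ)) ∧ Literature.NumberTheory.Automorphic.IsHeckePoint (Matrix.GeneralLinearGroup.map (n := Fin 2) (algebraMap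 K (IsDedekindDomain.FiniteAdeleRing (NumberField.RingOfIntegers K) K))) (Literature.NumberTheory.Automorphic.LevelTower.ofSeq U (fun r : ℕ => (Literature.NumberTheory.Automorphic.principalCongruenceLevel 2 K (Ideal.span {((p : ℕ) : NumberField.RingOfIntegers K)} ^ r)).map (Literature.NumberTheory.Automorphic.GLn.sndHom 2 K))) ((p : ℕ) : (Valued.v (R := PadicAlgCl p)).valuationSubring) (fun j : {v : IsDedekindDomain.HeightOneSpectrum (NumberField.RingOfIntegers K) // v ∉ S} × Fin 2 => Literature.NumberTheory.Automorphic.GLn.sndHom 2 K (Literature.NumberTheory.Automorphic.heckeDiagAt 2 K j.1.1 (ϖ j.1.1) (j.2.val + 1))) (fun j => a j.1 (j.2.val + 1)) ∧ ∀ (v : IsDedekindDomain.HeightOneSpectrum (NumberField.RingOfIntegers K)) (hv : v ∉ S), σ.IsHeckeAssociatedAt v (fun i : ℕ => if i = 0 then (1 : PadicAlgCl p) else ((a ⟨v, hv⟩ i : (Valued.v (R := PadicAlgCl p)).valuationSubring) : PadicAlgCl p))) → ∃ (hcpt : Literature.NumberTheory.Automorphic.isCompact_glFiniteIntegralLevel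 2 K) (π : Literature.NumberTheory.Automorphic.CuspidalAutomorphicRepData 2 K hcpt), ∀ᶠ w : IsDedekindDomain.HeightOneSpectrum (NumberField.RingOfIntegers K) in Filter.cofinite, Summit.Langlands.SatakeFrobCompatibleAt ι π.1 σ w) := by
  intro hR' K _ _ htc hdeg p _ ι σ hfin hirr hins hyp
  obtain ⟨S, U, ϖ, a, hSp, hopen, hle, hlev, hϖ, hpt, hassoc⟩ := hyp
  -- every `S₀`-good place lies outside `S`, for `S₀ := insert p (S.image absNorm)`
  have hgood : ∀ v : HeightOneSpectrum (𝓞 K),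
      (∀ ℓ ∈ insert p (S.image fun v : HeightOneSpectrum (𝓞 K) => Ideal.absNorm v.asIdeal),
        ((ℓ : ℕ) : 𝓞 K) ∉ v.asIdeal) → v ∉ S := by
    intro v hv hvS
    exact hv _ (Finset.mem_insert_of_mem (Finset.mem_image_of_mem _ hvS))
      (Ideal.absNorm_mem v.asIdeal)
  have h0 : (0 : ℕ) ∉ insert p (S.image fun v : HeightOneSpectrum (𝓞 K) => Ideal.absNorm v.asIdeal) := by
    intro h
    rcases Finset.mem_insert.mp h with h | h
    · exact (Fact.out : p.Prime).ne_zero h.symm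
    · obtain ⟨v, -, hv⟩ := Finset.mem_image.mp h
      exact v.ne_bot (Ideal.absNorm_eq_zero_iff.mp hv)
  have hp : p ∈ insert p (S.image fun v : HeightOneSpectrum (𝓞 K) => Ideal.absNorm v.asIdeal) :=
    Finset.mem_insert_self _ _
  -- the restriction map of index types
  let e : {v : HeightOneSpectrum (𝓞 K) //
      ∀ ℓ ∈ insert p (S.image fun v : HeightOneSpectrum (𝓞 K) => Ideal.absNorm v.asIdeal),
        ((ℓ : ℕ) : 𝓞 K) ∉ v.asIdeal} × Fin 2 → {v : HeightOneSpectrum (𝓞 K) // v ∉ S} × Fin 2 :=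
    fun j => (⟨j.1.1, hgood j.1.1 j.1.2⟩, j.2)
  have key := isHeckePoint_comp
      (Matrix.GeneralLinearGroup.map (n := Fin 2) (algebraMap K (FiniteAdeleRing (𝓞 K) K)))
      (LevelTower.ofSeq U (fun r : ℕ =>
        (principalCongruenceLevel 2 K (Ideal.span {((p : ℕ) : 𝓞 K)} ^ r)).map (GLn.sndHom 2 K)))
      ((p : ℕ) : (Valued.v (R := PadicAlgCl p)).valuationSubring) e
      (fun j : {v : HeightOneSpectrum (𝓞 K) // v ∉ S} × Fin 2 =>
        GLn.sndHom 2 K (heckeDiagAt 2 K j.1.1 (ϖ j.1.1) (j.2.val + 1)))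
      (fun j => a j.1 (j.2.val + 1)) hpt
  obtain ⟨hcpt, π, hall⟩ := hR' K htc hdeg p ι σ hfin hirr hins
    (insert p (S.image fun v : HeightOneSpectrum (𝓞 K) => Ideal.absNorm v.asIdeal)) hp
    ⟨U, ϖ, fun v n => a ⟨v.1, hgood v.1 v.2⟩ n, hopen, hle, fun g hg hgS =>
      hlev g hg fun v hvS => hgS v fun hv => hgood v hv hvS, hϖ, key,
      fun v hv => hassoc v (hgood v hv)⟩
  refine ⟨hcpt, π, ?_⟩
  rw [Filter.eventually_cofinite]
  exact (finite_setOf_not_good K _ h0).subset fun w hw hgw => hw (hall w hgw)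

/-- **The shared crux R from the icosahedral sector of R′, modulo Langlands–Tunnell only.**
`RuelleTorsionArtinWeight.ArtinWeightRealisation` (item stmt-Langlands-11057) follows from
`strongArtin_of_isSolvable` and the restriction of `ParityBlindBianchi.ArtinWeightRealisationLevel`
to finite-image irreducible `σ` with non-solvable projective image.  Solvable sector: `π := π(τ)`
for the contragredient transport `τ = ι ∘ σ^∨` (`exists_dual_transport_projectiveImage`,
`isIrreducible_of_dual_transport`, `isSolvable_projectiveImage_of_dual_transport`,
`satakeFrobCompatibleAt_iff_of_dual_transport`) — Langlands–Tunnell verbatim, the `p`-adic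
hypothesis unused; insoluble sector:
`artinWeightRealisation_insoluble_of_artinWeightRealisationLevel_insoluble`.  In this direction
neither the rigidity fact nor the cusp-form existence fact is needed. [folklore] -/
theorem artinWeightRealisation_of_artinWeightRealisationLevel_insoluble : Literature.NumberTheory.Automorphic.strongArtin_of_isSolvable → (∀ (K : Type) [Field K] [NumberField K], NumberField.IsTotallyComplex K → Module.finrank ℚ K = 2 → ∀ (p : ℕ) [Fact p.Prime] (ι : PadicAlgCl p ≃+* ℂ) (σ : Literature.NumberTheory.GaloisRepresentations.FramedGaloisRep K (PadicAlgCl p) 2), Finite σ.toMonoidHom.range → σ.toGaloisRep.IsIrreducible → ¬ IsSolvable (Literature.NumberTheory.GaloisRepresentations.projectiveImage σ.toMonoidHom) → ∀ S₀ : Finset ℕ, p ∈ S₀ → (∃ (U : Subgroup (GL (Fin 2) (IsDedekindDomain.FiniteAdeleRing (NumberField.RingOfIntegers K) K))) (ϖ : ∀ v : IsDedekindDomain.HeightOneSpectrum (NumberField.RingOfIntegers K), (v.adicCompletion K)ˣ) (a : {v : IsDedekindDomain.HeightOneSpectrum (NumberField.RingOfIntegers K) // ∀ ℓ ∈ S₀,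 ((ℓ : ℕ) : NumberField.RingOfIntegers K) ∉ v.asIdeal} → ℕ → (Valued.v (R := PadicAlgCl p)).valuationSubring), IsOpen (U : Set (GL (Fin 2) (IsDedekindDomain.FiniteAdeleRing (NumberField.RingOfIntegers K) K))) ∧ U ≤ Literature.NumberTheory.Automorphic.glFiniteIntegralLevel 2 K ∧ (∀ g ∈ Literature.NumberTheory.Automorphic.glFiniteIntegralLevel 2 K, (∀ v : IsDedekindDomain.HeightOneSpectrum (NumberField.RingOfIntegers K), ¬ (∀ ℓ ∈ S₀, ((ℓ : ℕ) : NumberField.RingOfIntegers K) ∉ v.asIdeal) → ∀ i j : Fin 2, ((g : Matrix (Fin 2) (Fin 2) (IsDedekindDomain.FiniteAdeleRing (NumberField.RingOfIntegers K) K)) i j) v = (1 : Matrix (Fin 2) (Fin 2) (v.adicCompletion K)) i j) → g ∈ U) ∧ (∀ v : IsDedekindDomain.HeightOneSpectrum (NumberField.RingOfIntegers K), Valued.v ((ϖ v : (v.adicCompletion K)ˣ) : v.adicCompletion K) = WithZero.exp (-1 : ℤ)) ∧ Literature.NumberTheory.Automorphic.IsHeckePoint (Matrix.GeneralLinearGroup.map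 (n := Fin 2) (algebraMap K (IsDedekindDomain.FiniteAdeleRing (NumberField.RingOfIntegers K) K))) (Literature.NumberTheory.Automorphic.LevelTower.ofSeq U (fun r : ℕ => (Literature.NumberTheory.Automorphic.principalCongruenceLevel 2 K (Ideal.span {((p : ℕ) : NumberField.RingOfIntegers K)} ^ r)).map (Literature.NumberTheory.Automorphic.GLn.sndHom 2 K))) ((p : ℕ) : (Valued.v (R := PadicAlgCl p)).valuationSubring) (fun j : {v : IsDedekindDomain.HeightOneSpectrum (NumberField.RingOfIntegers K) // ∀ ℓ ∈ S₀, ((ℓ : ℕ) : NumberField.RingOfIntegers K) ∉ v.asIdeal} × Fin 2 => Literature.NumberTheory.Automorphic.GLn.sndHom 2 K (Literature.NumberTheory.Automorphic.heckeDiagAt 2 K j.1.1 (ϖ j.1.1) (j.2.val + 1))) (fun j => a j.1 (j.2.val + 1)) ∧ ∀ (v : IsDedekindDomain.HeightOneSpectrum (NumberField.RingOfIntegers K)) (hv : ∀ ℓ ∈ S₀, ((ℓ : ℕ) : NumberField.RingOfIntegers K) ∉ v.asIdeal), σ.IsHeckeAssociatedAt v (fun i : ℕ => if i = 0 then (1 :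 PadicAlgCl p) else ((a ⟨v, hv⟩ i : (Valued.v (R := PadicAlgCl p)).valuationSubring) : PadicAlgCl p))) → ∃ (hcpt : Literature.NumberTheory.Automorphic.isCompact_glFiniteIntegralLevel 2 K) (π : Literature.NumberTheory.Automorphic.CuspidalAutomorphicRepData 2 K hcpt), ∀ w : IsDedekindDomain.HeightOneSpectrum (NumberField.RingOfIntegers K), (∀ ℓ ∈ S₀, ((ℓ : ℕ) : NumberField.RingOfIntegers K) ∉ w.asIdeal) → Summit.Langlands.SatakeFrobCompatibleAt ι π.1 σ w) → Summit.Langlands.Langlands.Theses.RuelleTorsionArtinWeight.ArtinWeightRealisation := by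
  intro hLT hR' K _ _ htc hdeg p _ ι σ hfin hirr hyp
  by_cases hs : IsSolvable (projectiveImage σ.toMonoidHom)
  · obtain ⟨τ, hτ, hfinτ, ⟨e⟩⟩ := exists_dual_transport_projectiveImage ι σ hfin
    have hirrτ : τ.toGaloisRep.IsIrreducible := isIrreducible_of_dual_transport σ hirr τ hfinτ e
    have hsolvτ : IsSolvable (projectiveImage τ.toMonoidHom) :=
      isSolvable_projectiveImage_of_dual_transport σ hs τ e
    obtain ⟨hcpt, π, hpi⟩ := hLT τ hirrτ hsolvτ
    exact ⟨hcpt, π,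
      hpi.mono fun w hw => (satakeFrobCompatibleAt_iff_of_dual_transport ι σ τ hτ π.1 w).2 hw⟩
  · exact artinWeightRealisation_insoluble_of_artinWeightRealisationLevel_insoluble hR' K htc hdeg p ι σ
      hfin hirr hs hyp

end Summit.Langlands.Langlands.Theorems.ArtinWeightRealisationLevel

end
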